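import Summits.AnomalousDissipation.AnomalousDissipation.Theorems.SawtoothPulseCascadeK1LocalisedCascadeClassStepCTS
import Summits.AnomalousDissipation.AnomalousDissipation.Theorems.SawtoothPulseCascadeK1LocalisedCascadeTraceBoxTrapezoid
import Summits.AnomalousDissipation.AnomalousDissipation.Theorems.SawtoothPulseCascadeK1LocalisedCascadeCornerTraceCount

/-!
# K1loc, line `Spectral` — helper: THE CT WINDOW BLOCKS WITH ALL SCALARS DISCHARGED (S-D, arbiter A24-3 (4): p1 = the
phase-3 CT scalar instances)

`…ClassStepCTS.sum_window_iterate_{v,h}step_ct_split_le` for the cascade iterates with the symmetric box-product trapezoid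
`χ_l = N(l)/R` (plateau `|l| ≤ L`, ramps `R`, sources `|l| ≤ L+R`) and EVERY scalar hypothesis discharged by a landed lemma:
`Θ⁺ = Θ⁻ = ((√((2L+R)R)/R)·1)²/2` (`…TraceBoxTrapezoid`, real input, sign-symmetric fibre set), `E = 1` (`…CTScalars`),
`M_c = 2(L+R)/N_j + 1` (`…CornerTraceCount`), `η = π(Λ'G)ε/N_j` for any `ε ≥ e^{−M²/2}` (`…CTScalars.eta_ct_le`).  What is
left symbolic: the block geometry (`L, R, Λ, Λ', p, D_m`), the zone parameter `M` (`1 ≤ M`, `Mδ_j < π/2`) and `ε`.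
-/

-- `Summit.<Summit>.<Problem>`: single-conjunct summit, the duplicate namespace segment is deliberate.
set_option linter.dupNamespace false

namespace Summit.AnomalousDissipation.AnomalousDissipation.Theorems.SawtoothPulseCascade.K1Window

open MeasureTheory Set Filter Topology UnitAddTorus Function Complex Metric
open scoped Real ENNReal
open Literature.Analysis Literature.Analysis.FunctionSpaces Literature.Analysis.FunctionSpaces.Torus Literature.Analysis.FluidPDE
open Literature.Analysis.FluidPDE.ShearStage
open Literature.Analysis.FluidPDE.SawtoothCascade Literature.Analysis.FluidPDE.SawtoothCascade.CascadeParams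
open Summit.AnomalousDissipation.AnomalousDissipation.Theorems.SawtoothPulseCascade.K1Start
open Summit.AnomalousDissipation.AnomalousDissipation.Theorems.SawtoothPulseCascade.K1Flat
open Summit.AnomalousDissipation.AnomalousDissipation.Theorems.SawtoothPulseCascade.K1Ledger.From

section Cascade

variable (P : CascadeParams)

/-- **CT V window block for the iterates, box trapezoid, all scalars discharged.**  Block: `Λ ≤ |k₁| ≤ Λ'`,
`|k₀| + (L+R) ≤ p(k₁)`, `p(k₁) + D_m ≤ |k₁|G`, sign-symmetric fibre set; zone parameter `M`, `e^{−M²/2} ≤ ε`.  Bound: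
`Σ_{k∈W}|𝓕a_{j+1}(k)|² ≤ (√(3N_jσ/π²·2N_j(Θ/2+Θ/2) + 12N_j²(L+R)²(2(L+R)/N_j+1)σ/(π²D_m²)·1) + √((πΛ'Gε/N_j)²·1 + 8Mδ_j(Θ/2+Θ/2)/π)
 + √PT)²`, `Θ = (√((2L+R)R)/R·1)²`, `σ = 1/(D_m+L+R)² + 1/(N_j(D_m+L+R))`. [cite: Grafakos2014, Prop. 3.1.2 (5), Prop. 3.2.7 (3)] -/
theorem sum_window_iterate_vstep_ct_box_le {G : ℕ} (hγ : P.γ = G) (hδ₀ : 0 < P.δ₀) (hd : 0 < P.d) (hN₀ : 1 ≤ P.N₀)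
    (hρN : 1 ≤ P.ρN) (a b : ℕ → UnitAddTorus (Fin 2) → ℝ) (has : ∀ j, IsSmooth (a j)) (h0 : a 0 = datum)
    (hb : ∀ j, b j = a j ∘ shearMap 0 1 (amp ⟨P.U j, P.U_periodic j, P.contDiff_U (P.δ_pos hδ₀ hd j)⟩ P.γ))
    (hab : ∀ j, a (j + 1) = b j ∘ shearMap 1 0 (amp ⟨P.U j, P.U_periodic j, P.contDiff_U (P.δ_pos hδ₀ hd j)⟩ P.γ))
    (j : ℕ) {L R Λ Λ' Dm : ℕ} (hR : 0 < R) (p : ℤ → ℕ)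
    (W : Finset (Fin 2 → ℤ)) (hW : ∀ k ∈ W, (Λ : ℤ) ≤ |k 1| ∧ |k 1| ≤ Λ')
    (hWp : ∀ k ∈ W, |k 0| + ((L + R : ℕ) : ℤ) ≤ (p (k 1) : ℤ)) (hDm : 0 < Dm)
    (hD : ∀ k ∈ W, (p (k 1) : ℤ) + Dm ≤ |k 1| * G)
    (hWsym : ∀ n ∈ W.image (fun k => k 1), -n ∈ W.image (fun k => k 1))
    {M ε : ℝ} (hM : 1 ≤ M) (hMδ : M * P.δ j < π / 2) (hε : Real.exp (-(M ^ 2 / 2)) ≤ ε) :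
    ∑ k ∈ W, ‖mFourierCoeff (fun x => (a (j + 1) x : ℂ)) k‖ ^ 2 ≤
      (Real.sqrt (3 * P.N j * (1 / ((Dm : ℝ) + ((L + R : ℕ) : ℝ)) ^ 2 + 1 / (P.N j * ((Dm : ℝ) + ((L + R : ℕ) : ℝ)))) /
              π ^ 2 * (2 * P.N j * ((Real.sqrt ((2 * L + R : ℕ) * R) / R * 1) ^ 2 / 2 +
                (Real.sqrt ((2 * L + R : ℕ) * R) / R * 1) ^ 2 / 2)) +
            12 * (P.N j : ℝ) ^ 2 * ((L + R : ℕ) : ℝ) ^ 2 * (2 * ((L + R : ℕ) : ℝ) / P.N j + 1) *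
              (1 / ((Dm : ℝ) + ((L + R : ℕ) : ℝ)) ^ 2 + 1 / (P.N j * ((Dm : ℝ) + ((L + R : ℕ) : ℝ)))) /
              (π ^ 2 * (Dm : ℝ) ^ 2) * 1) +
          Real.sqrt ((π * ((Λ' * G : ℕ) : ℝ) * ε / P.N j) ^ 2 * 1 +
            8 * M * P.δ j / π * ((Real.sqrt ((2 * L + R : ℕ) * R) / R * 1) ^ 2 / 2 +
              (Real.sqrt ((2 * L + R : ℕ) * R) / R * 1) ^ 2 / 2)) +
        Real.sqrt (∑' k : Fin 2 → ℤ, (if (Λ : ℤ) ≤ |k 1| ∧ |k 1| ≤ Λ' ∧ (L : ℤ) < |k 0| then (1 : ℝ) else 0) *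
          ‖mFourierCoeff (fun x => (b j x : ℂ)) k‖ ^ 2)) ^ 2 := by
  have hNpos : 0 < P.N j := N_pos P hN₀ hρN j
  have hbs : IsSmooth (b j) := isSmooth_b P hδ₀ hd a b has hb j
  have hb1 : ∀ x, |b j x| ≤ 1 := (abs_iterate_le_one P hδ₀ hd a b h0 hb hab j).2
  have hΘ := fun y : ℝ => sum_sq_trace_boxTrapezoid_sign_le_v hbs.continuous hb1 L hR (W.image fun k => k 1) hWsym y
  exact sum_window_iterate_vstep_ct_split_le P hγ hδ₀ hd hN₀ hρN a b has hb hab j _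
    (fun l hl => boxTrapezoid_support L R l hl) (boxTrapezoid_real L hR) (fun l hl => boxTrapezoid_plateau L hR l hl)
    p W hW hWp hDm hD (fun k => card_filter_Icc_dvd_sub_le hNpos (L + R) k) (fun y => (hΘ y).1) (fun y => (hΘ y).2)
    (sum_trackedEnergy_iterate_vstep_le_one P hδ₀ hd a b has h0 hb hab j _ (boxTrapezoid_real L hR) W (L + R))
    hM hMδ (eta_ct_le Λ' G hNpos hε)

/-- **CT H window block for the iterates, box trapezoid, all scalars discharged** (`a_j ↦ b_j`; fibres `k₀`, sources in
`k₁`). [cite: Grafakos2014, Prop. 3.1.2 (5), Prop. 3.2.7 (3)] -/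
theorem sum_window_iterate_hstep_ct_box_le {G : ℕ} (hγ : P.γ = G) (hδ₀ : 0 < P.δ₀) (hd : 0 < P.d) (hN₀ : 1 ≤ P.N₀)
    (hρN : 1 ≤ P.ρN) (a b : ℕ → UnitAddTorus (Fin 2) → ℝ) (has : ∀ j, IsSmooth (a j)) (h0 : a 0 = datum)
    (hb : ∀ j, b j = a j ∘ shearMap 0 1 (amp ⟨P.U j, P.U_periodic j, P.contDiff_U (P.δ_pos hδ₀ hd j)⟩ P.γ))
    (hab : ∀ j, a (j + 1) = b j ∘ shearMap 1 0 (amp ⟨P.U j, P.U_periodic j, P.contDiff_U (P.δ_pos hδ₀ hd j)⟩ P.γ))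
    (j : ℕ) {L R Λ Λ' Dm : ℕ} (hR : 0 < R) (p : ℤ → ℕ)
    (W : Finset (Fin 2 → ℤ)) (hW : ∀ k ∈ W, (Λ : ℤ) ≤ |k 0| ∧ |k 0| ≤ Λ')
    (hWp : ∀ k ∈ W, |k 1| + ((L + R : ℕ) : ℤ) ≤ (p (k 0) : ℤ)) (hDm : 0 < Dm)
    (hD : ∀ k ∈ W, (p (k 0) : ℤ) + Dm ≤ |k 0| * G)
    (hWsym : ∀ n ∈ W.image (fun k => k 0), -n ∈ W.image (fun k => k 0))
    {M ε : ℝ} (hM : 1 ≤ M) (hMδ : M * P.δ j < π / 2) (hε : Real.exp (-(M ^ 2 / 2)) ≤ ε) :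
    ∑ k ∈ W, ‖mFourierCoeff (fun x => (b j x : ℂ)) k‖ ^ 2 ≤
      (Real.sqrt (3 * P.N j * (1 / ((Dm : ℝ) + ((L + R : ℕ) : ℝ)) ^ 2 + 1 / (P.N j * ((Dm : ℝ) + ((L + R : ℕ) : ℝ)))) /
              π ^ 2 * (2 * P.N j * ((Real.sqrt ((2 * L + R : ℕ) * R) / R * 1) ^ 2 / 2 +
                (Real.sqrt ((2 * L + R : ℕ) * R) / R * 1) ^ 2 / 2)) +
            12 * (P.N j : ℝ) ^ 2 * ((L + R : ℕ) : ℝ) ^ 2 * (2 * ((L + R : ℕ) : ℝ) / P.N j + 1) *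
              (1 / ((Dm : ℝ) + ((L + R : ℕ) : ℝ)) ^ 2 + 1 / (P.N j * ((Dm : ℝ) + ((L + R : ℕ) : ℝ)))) /
              (π ^ 2 * (Dm : ℝ) ^ 2) * 1) +
          Real.sqrt ((π * ((Λ' * G : ℕ) : ℝ) * ε / P.N j) ^ 2 * 1 +
            8 * M * P.δ j / π * ((Real.sqrt ((2 * L + R : ℕ) * R) / R * 1) ^ 2 / 2 +
              (Real.sqrt ((2 * L + R : ℕ) * R) / R * 1) ^ 2 / 2)) +
        Real.sqrt (∑' k : Fin 2 → ℤ, (if (Λ : ℤ) ≤ |k 0| ∧ |k 0| ≤ Λ' ∧ (L : ℤ) < |k 1| then (1 : ℝ) else 0) *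
          ‖mFourierCoeff (fun x => (a j x : ℂ)) k‖ ^ 2)) ^ 2 := by
  have hNpos : 0 < P.N j := N_pos P hN₀ hρN j
  have ha1 : ∀ x, |a j x| ≤ 1 := (abs_iterate_le_one P hδ₀ hd a b h0 hb hab j).1
  have hΘ := fun y : ℝ => sum_sq_trace_boxTrapezoid_sign_le_h (has j).continuous ha1 L hR (W.image fun k => k 0) hWsym y
  exact sum_window_iterate_hstep_ct_split_le P hγ hδ₀ hd hN₀ hρN a b has hb j _
    (fun l hl => boxTrapezoid_support L R l hl) (boxTrapezoid_real L hR) (fun l hl => boxTrapezoid_plateau L hR l hl)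
    p W hW hWp hDm hD (fun k => card_filter_Icc_dvd_sub_le hNpos (L + R) k) (fun y => (hΘ y).1) (fun y => (hΘ y).2)
    (sum_trackedEnergy_iterate_hstep_le_one P hδ₀ hd a b has h0 hb hab j _ (boxTrapezoid_real L hR) W (L + R))
    hM hMδ (eta_ct_le Λ' G hNpos hε)

end Cascade

end Summit.AnomalousDissipation.AnomalousDissipation.Theorems.SawtoothPulseCascade.K1Window
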